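import Summits.Ventures.HSemireg.Pad4FirstOrderModelColumnReading

/-!
# Venture HSemireg — THEOREM L^ζ step S3 (continued): THE SERVER ROWS (R1) AND THE FOREIGN-FLAG ROWS (R2) of the top
# flag's column (companion of `Pad4FirstOrderModel.lean`, row 716; TIER-2 step S3, second file)

HONEST FRAMING. PROVED statements about the first-order MODEL of the PAD-4 anchor (seat s4-prove-1 g24, TRACK S4-PUSH lane
(ii), 2026-08-27). `TheoremLZetaMain` ∕ `TheoremLZeta` (p505821) stay kernel-OPEN (`@[conjecture]`); nothing here proves them.
WHAT IS PROVED (notation of `Pad4FirstOrderModelColumnReading.lean`: top flag `X = a ℓ^{(σ)} + h ℓ_ζ^{(f)}`, one solution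
`η` of `X`'s column at `κ₀ = E_{fσ}`, `v_j(x, y) = η_j(qPair σ f, [σ ↦ x, f ↦ y])`, `u_j(x) = v_j(x, ē_B) − ζ̄ v_j(x, ē_A)`):
(R1) `column_reading_R1` — for every f-SERVER `S = N r = s ℓ_ζ^{(f)}`, `s > h`, every `x ∈ R_a`, `o ∈ R_{s−h}`:
`Σ_{copies j of Q₀} u_j(x) φ_{S j}(o) + Σ_{companions C = P j, h < c < s} Σ_{ι' ∈ R_{c−h}, a' ∈ R_{s−c}} mulCoef(ι', a', o) v_j(x, ι') φ_{S C}(a') = 0`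
— the row of `S` on the block `R_a^* ⊗ R_{s−h} ⊗ W` of `H²(S − X)`: copies of `Q₀` enter through `w_ζ ⊗ id`
(`V_f · R_{s−h} → R_{s−h} ⊗ W`), companions through the ring product, pure-f `P`'s below `h` not at all (`e > d`), `c = s`
by `Minimal`; (R2) `column_reading_R2` — for every FLAG `X' = N r = a' ℓ_{ζ'}^{(τ)} + h ℓ_ζ^{(f)}` on an axis `τ ∉ {σ, f}`,
every `x ∈ R_a`, `o ∈ R_{a'}`: `Σ_{copies j of Q₀} u_j(x) φ_{X' j}(o) = 0` — the `w_ζ`-image (f-index) of the row of `X'` on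
the block `R_a^* ⊗ V_f ⊗ R_{a'}`: pairs below `h` on `f` feed `ξ̄_ζ^{(f)}` (S3a `coefProd_wImage_eq_zero_of_eval`), τ-ray
partners of `X'` charged on `τ` are `≥ 2`-charged at height `h` ((F1) `noP`), `X'`'s own class is killed by `Minimal`.
`column_reading` packages (D), (R1), (R2) from `LowerColumnSolvable φ κ₀ i`. PAD4-THEOREM-L §2 (R1)(R2) in the kernel.
THE END is NOT in this file. No variety, sheaf or semiregularity map is constructed; nothing here says HC ∕ HC_CM ∕ HC_AV
holds; no fact, no definition, no instance, no notation. REUSE: rows 716, 731, 739, S2a, S2c, S3a, S3 (first file).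
FRAMING OF RECORD (director-hodge g10, cell INBOX l.31483 (a)): everything in this file is a theorem of the finite-dimensional
FIRST-ORDER MODEL of row 716 (`Pad4FirstOrderModel.lean`) and of nothing else; the model-to-sheaf bridge (Buchweitz–Flenner 2003)
is NOT in the tree; the cell's (S3) ∕ (S5) STATUS WORDS do not move; no object is certified; nothing here bears on HC ∕ HC_CM ∕
HC_AV ∕ W₆ or on `stub_rung_pad4_seedAt`.
Typed ≠ proved ≠ endorsed.
-/

noncomputable section
namespace Summit.Ventures.HSemireg.Pad4FirstOrder
open Finset

section Rows
variable {D : Design} {φ : D.Sections} (T : TopFlag D φ)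

/-! ## Indicator sums -/

/-- `Σ_{z ∈ s} [z = x] · F z = F x` for `x ∈ s`. -/
theorem sum_ite_eq_mul_left {s : Finset (ℕ × ℕ)} {x : ℕ × ℕ} (hx : x ∈ s) (F : ℕ × ℕ → ℂ) :
    ∑ z ∈ s, (if z = x then (1 : ℂ) else 0) * F z = F x := by
  rw [Finset.sum_eq_single_of_mem x hx (fun z _ hz => by rw [if_neg hz, zero_mul]), if_pos rfl, one_mul]

/-- `Σ_{z ∈ s} [x = z] · F z = F x` for `x ∈ s`. -/
theorem sum_ite_eq_mul_right {s : Finset (ℕ × ℕ)} {x : ℕ × ℕ} (hx : x ∈ s) (F : ℕ × ℕ → ℂ) :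
    ∑ z ∈ s, (if x = z then (1 : ℂ) else 0) * F z = F x := by
  rw [Finset.sum_eq_single_of_mem x hx (fun z _ hz => by rw [if_neg (Ne.symm hz), zero_mul]), if_pos rfl, one_mul]

/-! ## (R1): the row of an f-server -/

/-- a server against a copy of `Q₀`, per factor: `S − Q₀ = (s − h) ℓ_ζ^{(f)}`, class `0` off `f`. -/
theorem TopFlag.isServer_rel_Q0 {r : Fin D.nN} (hr : T.IsServer r) {j : Fin D.nP} (hj : T.IsQ0 j) :
    rel (D.N r) (D.P j) T.f = Rel.pos ((D.N r).charge T.f - (D.N T.i).charge T.f) ((D.N T.i).phase T.f) ∧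
    ∀ g, g ≠ T.f → rel (D.N r) (D.P j) g = Rel.zero := by
  obtain ⟨hQl, hQf, hQph, hQ0⟩ := topFlag_Q0 D φ T j hj
  obtain ⟨hSl, hSph, hlt, hS0⟩ := hr
  refine ⟨?_, fun g hg => rel_zero_of_eq _ _ g (hSl.trans hQl.symm) (by rw [hS0 g hg, hQ0 g hg]) (Or.inl (hQ0 g hg))⟩
  rw [rel_pos_of_lt _ _ T.f (hSl.trans hQl.symm) (by rw [hQf]; exact hlt) (Or.inr (hSph.trans hQph.symm)), hQf, hSph]

/-- (R1), a copy of `Q₀`: its term of the server row at `(qPair σ f, [σ ↦ x, f ↦ o])` is `u_j(x) · φ_{S j}(o)`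
(identity on `R_a^*`; `V_f · R_{s−h} → R_{s−h} ⊗ W` is `w_ζ`). -/
theorem server_term_isQ0 (η : Fin D.nP → (Fin 4 → ℕ) → (Fin 4 → ℕ × ℕ) → ℂ) {r : Fin D.nN} (hr : T.IsServer r)
    {j : Fin D.nP} (hj : T.IsQ0 j) {x : ℕ × ℕ} (hx : x ∈ monIdx ((D.N T.i).charge T.σ)) {o : ℕ × ℕ}
    (ho : o ∈ monIdx ((D.N r).charge T.f - (D.N T.i).charge T.f)) :
    ∑ u ∈ idxH2 (D.P j) (D.N T.i), ∑ a ∈ idxH0 (D.N r) (D.P j),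
        (if u.1 = qPair T.σ T.f then coefProd (rel (D.P j) (D.N T.i)) (rel (D.N r) (D.P j)) (qPair T.σ T.f) u.2 a
          (Function.update (Function.update (fun _ => ((0 : ℕ), (0 : ℕ))) T.σ x) T.f o) else 0) * φ r j a * η j u.1 u.2 =
      (η j (qPair T.σ T.f) (Function.update (Function.update (fun _ => ((0 : ℕ), (0 : ℕ))) T.σ x) T.f (1, 0)) -
          zetaBar ((D.N T.i).phase T.f) *
            η j (qPair T.σ T.f) (Function.update (Function.update (fun _ => ((0 : ℕ), (0 : ℕ))) T.σ x) T.f (0, 0))) *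
        φ r j (Function.update (fun _ => ((0 : ℕ), (0 : ℕ))) T.f o) := by
  obtain ⟨hσU, -, hU0, -⟩ := T.isQ0_rel hj
  obtain ⟨hfS, hS0⟩ := T.isServer_rel_Q0 hr hj
  rw [term_restrict _ _ _ _ _ (qPair_mem_qDist2 _ _ T.hσf),
    sum_piFinset_pair _ T.σ T.f T.hσf (fun g hgσ hgf => by rw [hU0 g hgσ, qPair_of_ne hgσ hgf, idx_zero_zero]),
    hσU, qPair_left, idx_neg_one, hU0 T.f T.hσf.symm, qPair_right, idx_zero_one]
  have hc : ∀ x' y' z : ℕ × ℕ, coefProd (rel (D.P j) (D.N T.i)) (rel (D.N r) (D.P j)) (qPair T.σ T.f)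
      (Function.update (Function.update (fun _ => ((0 : ℕ), (0 : ℕ))) T.σ x') T.f y')
      (Function.update (fun _ => ((0 : ℕ), (0 : ℕ))) T.f z)
      (Function.update (Function.update (fun _ => ((0 : ℕ), (0 : ℕ))) T.σ x) T.f o) =
      (if x = x' then 1 else 0) * (wCoef ((D.N T.i).phase T.f) y' * (if o = z then 1 else 0)) := by
    intro x' y' z
    rw [coefProd_split2 _ _ _ _ _ _ T.σ T.f T.hσf (fun g hgσ hgf => by
      rw [hS0 g hgf, coef_zero_right, update_update_apply_of_ne hgσ hgf, update_update_apply_of_ne hgσ hgf,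
        if_pos rfl]), hσU, hfS, hU0 T.f T.hσf.symm, hS0 T.σ T.hσf, qPair_left, qPair_right]
    simp only [Function.update_self, Function.update_of_ne T.hσf, coef_zero_right, coef_zero_one_pos]
  have inner : ∀ x' y' : ℕ × ℕ, ∑ a ∈ idxH0 (D.N r) (D.P j), coefProd (rel (D.P j) (D.N T.i)) (rel (D.N r) (D.P j))
      (qPair T.σ T.f) (Function.update (Function.update (fun _ => ((0 : ℕ), (0 : ℕ))) T.σ x') T.f y') a
      (Function.update (Function.update (fun _ => ((0 : ℕ), (0 : ℕ))) T.σ x) T.f o) * φ r j a =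
      (if x = x' then 1 else 0) * (wCoef ((D.N T.i).phase T.f) y' * φ r j (Function.update (fun _ => ((0 : ℕ), (0 : ℕ))) T.f o)) := by
    intro x' y'
    unfold idxH0
    rw [sum_piFinset_single _ T.f (fun g hg => by rw [hS0 g hg, idx_zero_zero]), hfS, idx_pos_zero,
      Finset.sum_congr rfl (fun z _ => by rw [hc x' y' z])]
    by_cases hxx : x = x'
    · rw [if_pos hxx, Finset.sum_eq_single_of_mem o ho (fun z _ hz => by rw [if_neg (Ne.symm hz)]; ring), if_pos rfl]
      ring
    · rw [if_neg hxx]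
      simp
  simp_rw [inner]
  rw [Finset.sum_eq_single_of_mem x hx (fun x' _ hx' => by simp [if_neg (Ne.symm hx')]),
    Finset.sum_pair (by decide : ((0 : ℕ), (0 : ℕ)) ≠ (1, 0)), wCoef_A, wCoef_B, if_pos rfl]
  ring

/-- a server against a companion below it, per factor: `S − C = (s − c) ℓ_ζ^{(f)}`, class `0` off `f`; and the companion
against the flag: `C − X = −a ℓ^{(σ)} + (c − h) ℓ_ζ^{(f)}`. -/
theorem TopFlag.isServer_rel_comp {r : Fin D.nN} (hr : T.IsServer r) {j : Fin D.nP} (hj : T.IsComp j)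
    (hlt : (D.P j).charge T.f < (D.N r).charge T.f) :
    rel (D.N r) (D.P j) T.f = Rel.pos ((D.N r).charge T.f - (D.P j).charge T.f) ((D.N T.i).phase T.f) ∧
    (∀ g, g ≠ T.f → rel (D.N r) (D.P j) g = Rel.zero) ∧
    rel (D.P j) (D.N T.i) T.σ = Rel.neg ((D.N T.i).charge T.σ) ((D.N T.i).phase T.σ) ∧
    rel (D.P j) (D.N T.i) T.f = Rel.pos ((D.P j).charge T.f - (D.N T.i).charge T.f) ((D.N T.i).phase T.f) ∧
    (∀ g, g ≠ T.σ → g ≠ T.f → rel (D.P j) (D.N T.i) g = Rel.zero) := by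
  obtain ⟨hSl, hSph, hSlt, hS0⟩ := hr
  obtain ⟨hCl, hCph, hClt, hC0⟩ := hj
  refine ⟨?_, fun g hg => rel_zero_of_eq _ _ g (hSl.trans hCl.symm) (by rw [hS0 g hg, hC0 g hg]) (Or.inl (hC0 g hg)),
    rel_uncharged_charged _ _ T.σ hCl (hC0 T.σ T.hσf) T.flag_σ, ?_,
    fun g hgσ hgf => rel_zero_of_eq _ _ g hCl (by rw [hC0 g hgf, T.flag_supp g hgσ hgf]) (Or.inl (T.flag_supp g hgσ hgf))⟩
  · rw [rel_pos_of_lt _ _ T.f (hSl.trans hCl.symm) hlt (Or.inr (hSph.trans hCph.symm)), hSph]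
  · rw [rel_pos_of_lt _ _ T.f hCl hClt (Or.inr hCph), hCph]

/-- (R1), a companion `C = c ℓ_ζ^{(f)}`, `h < c < s`: its term of the server row at `(qPair σ f, [σ ↦ x, f ↦ o])` is the ring
product `Σ_{ι' ∈ R_{c−h}, a' ∈ R_{s−c}} mulCoef(ι', a', o) · v_j(x, ι') · φ_{S C}(a')`. -/
theorem server_term_isComp (η : Fin D.nP → (Fin 4 → ℕ) → (Fin 4 → ℕ × ℕ) → ℂ) {r : Fin D.nN} (hr : T.IsServer r)
    {j : Fin D.nP} (hj : T.IsComp j) (hlt : (D.P j).charge T.f < (D.N r).charge T.f) {x : ℕ × ℕ}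
    (hx : x ∈ monIdx ((D.N T.i).charge T.σ)) (o : ℕ × ℕ) :
    ∑ u ∈ idxH2 (D.P j) (D.N T.i), ∑ a ∈ idxH0 (D.N r) (D.P j),
        (if u.1 = qPair T.σ T.f then coefProd (rel (D.P j) (D.N T.i)) (rel (D.N r) (D.P j)) (qPair T.σ T.f) u.2 a
          (Function.update (Function.update (fun _ => ((0 : ℕ), (0 : ℕ))) T.σ x) T.f o) else 0) * φ r j a * η j u.1 u.2 =
      ∑ ι' ∈ monIdx ((D.P j).charge T.f - (D.N T.i).charge T.f),
        ∑ a' ∈ monIdx ((D.N r).charge T.f - (D.P j).charge T.f),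
          (mulCoef ι' a' o : ℂ) *
            η j (qPair T.σ T.f) (Function.update (Function.update (fun _ => ((0 : ℕ), (0 : ℕ))) T.σ x) T.f ι') *
            φ r j (Function.update (fun _ => ((0 : ℕ), (0 : ℕ))) T.f a') := by
  obtain ⟨hfS, hS0, hσU, hfU, hU0⟩ := T.isServer_rel_comp hr hj hlt
  rw [term_restrict _ _ _ _ _ (qPair_mem_qDist2 _ _ T.hσf),
    sum_piFinset_pair _ T.σ T.f T.hσf (fun g hgσ hgf => by rw [hU0 g hgσ hgf, qPair_of_ne hgσ hgf, idx_zero_zero]),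
    hσU, qPair_left, idx_neg_one, hfU, qPair_right, idx_pos_one]
  have hc : ∀ x' ι' z : ℕ × ℕ, coefProd (rel (D.P j) (D.N T.i)) (rel (D.N r) (D.P j)) (qPair T.σ T.f)
      (Function.update (Function.update (fun _ => ((0 : ℕ), (0 : ℕ))) T.σ x') T.f ι')
      (Function.update (fun _ => ((0 : ℕ), (0 : ℕ))) T.f z)
      (Function.update (Function.update (fun _ => ((0 : ℕ), (0 : ℕ))) T.σ x) T.f o) =
      (if x = x' then 1 else 0) * (mulCoef ι' z o : ℂ) := by
    intro x' ι' z
    rw [coefProd_split2 _ _ _ _ _ _ T.σ T.f T.hσf (fun g hgσ hgf => by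
      rw [hS0 g hgf, coef_zero_right, update_update_apply_of_ne hgσ hgf, update_update_apply_of_ne hgσ hgf,
        if_pos rfl]), hσU, hfS, hfU, hS0 T.σ T.hσf, qPair_left, qPair_right]
    simp only [Function.update_self, Function.update_of_ne T.hσf, coef_zero_right, coef_pos_pos]
  have inner : ∀ x' ι' : ℕ × ℕ, ∑ a ∈ idxH0 (D.N r) (D.P j), coefProd (rel (D.P j) (D.N T.i)) (rel (D.N r) (D.P j))
      (qPair T.σ T.f) (Function.update (Function.update (fun _ => ((0 : ℕ), (0 : ℕ))) T.σ x') T.f ι') a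
      (Function.update (Function.update (fun _ => ((0 : ℕ), (0 : ℕ))) T.σ x) T.f o) * φ r j a =
      (if x = x' then 1 else 0) * ∑ a' ∈ monIdx ((D.N r).charge T.f - (D.P j).charge T.f),
        (mulCoef ι' a' o : ℂ) * φ r j (Function.update (fun _ => ((0 : ℕ), (0 : ℕ))) T.f a') := by
    intro x' ι'
    unfold idxH0
    rw [sum_piFinset_single _ T.f (fun g hg => by rw [hS0 g hg, idx_zero_zero]), hfS, idx_pos_zero, Finset.mul_sum]
    refine Finset.sum_congr rfl fun z _ => ?_
    rw [hc x' ι' z, mul_assoc]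
  simp_rw [inner]
  rw [Finset.sum_eq_single_of_mem x hx (fun x' _ hx' => by simp [if_neg (Ne.symm hx')])]
  refine Finset.sum_congr rfl fun ι' _ => ?_
  rw [if_pos rfl, one_mul, Finset.sum_mul]
  refine Finset.sum_congr rfl fun a' _ => ?_
  ring

/-- (R1), every other `P j` contributes nothing to the server row at this block: no section `P j → S` at all, or a pure-f
`P j` below `h` (`R_{h−c}^* × R_{s−c} → 0`, `e > d`), or `P j` of `S`'s own class (`Minimal`). -/
theorem server_term_zero (hmin : D.Minimal φ) (η : Fin D.nP → (Fin 4 → ℕ) → (Fin 4 → ℕ × ℕ) → ℂ) {r : Fin D.nN}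
    (hr : T.IsServer r) {j : Fin D.nP} (hjQ : ¬ T.IsQ0 j) (hjC : ¬ (T.IsComp j ∧ (D.P j).charge T.f < (D.N r).charge T.f))
    (x o : ℕ × ℕ) :
    ∑ u ∈ idxH2 (D.P j) (D.N T.i), ∑ a ∈ idxH0 (D.N r) (D.P j),
        (if u.1 = qPair T.σ T.f then coefProd (rel (D.P j) (D.N T.i)) (rel (D.N r) (D.P j)) (qPair T.σ T.f) u.2 a
          (Function.update (Function.update (fun _ => ((0 : ℕ), (0 : ℕ))) T.σ x) T.f o) else 0) * φ r j a * η j u.1 u.2 =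
      0 := by
  obtain ⟨hSl, hSph, hSlt, hS0⟩ := hr
  by_cases hne : (idxH0 (D.N r) (D.P j)).Nonempty
  swap
  · rw [Finset.not_nonempty_iff_eq_empty.mp hne]
    simp
  obtain ⟨hl, hP0⟩ := (idxH0_nonempty_iff _ _).1 hne
  have hPg : ∀ g, g ≠ T.f → (D.P j).charge g = 0 := fun g hg => by
    rcases hP0 g with h0 | ⟨-, hle⟩
    · exact h0
    · have := hS0 g hg; omega
  refine Finset.sum_eq_zero fun u _ => Finset.sum_eq_zero fun a ha => ?_
  by_cases hu1 : u.1 = qPair T.σ T.f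
  swap
  · rw [if_neg hu1]; ring
  rw [if_pos hu1]
  -- the f-charge `c` of `P j`: below `h`, equal to `h` (a copy of `Q₀`), between (a companion), or `s` (`S`'s class)
  rcases Nat.lt_or_ge ((D.P j).charge T.f) ((D.N T.i).charge T.f) with hlt | hge
  · -- `c < h`: the `f`-factor is `R_{h−c}^* × R_{s−c} → 0`
    have hph : (D.P j).charge T.f = 0 ∨ (D.N T.i).phase T.f = (D.P j).phase T.f := by
      rcases hP0 T.f with h0 | ⟨hp, -⟩
      · exact Or.inl h0
      · exact Or.inr (hSph.symm.trans hp)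
    have hU : rel (D.P j) (D.N T.i) T.f = Rel.neg ((D.N T.i).charge T.f - (D.P j).charge T.f) ((D.N T.i).phase T.f) :=
      rel_of_lt _ _ T.f (hl.symm.trans hSl) hlt hph
    have hS : rel (D.N r) (D.P j) T.f = Rel.pos ((D.N r).charge T.f - (D.P j).charge T.f) ((D.N r).phase T.f) :=
      rel_pos_of_lt _ _ T.f hl (by omega) (by
        rcases hP0 T.f with h0 | ⟨hp, -⟩
        · exact Or.inl h0
        · exact Or.inr hp)
    rw [coefProd_eq_zero_of_factor _ _ _ _ _ _ T.f (by
      rw [hU, hS, qPair_right]; exact coef_neg_pos_gt _ _ _ _ _ _ _ _ (by omega))]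
    ring
  · rcases hP0 T.f with h0 | ⟨hp, hle⟩
    · exfalso; have := T.flag_f; omega
    rcases Nat.lt_or_ge ((D.N T.i).charge T.f) ((D.P j).charge T.f) with hgt | hle'
    · -- `h < c`: a companion (then `c < s` is excluded by `hjC`) or `c = s` (`S`'s class: `Minimal`)
      have hC : T.IsComp j := ⟨hl.symm.trans hSl, hp.symm.trans hSph, hgt, hPg⟩
      have hcs : (D.P j).charge T.f = (D.N r).charge T.f := by
        by_contra hne'
        exact hjC ⟨hC, by omega⟩
      have hall : ∀ g, rel (D.N r) (D.P j) g = Rel.zero := fun g => by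
        by_cases hg : g = T.f
        · rw [hg]; exact rel_zero_of_eq _ _ _ hl hcs.symm (Or.inr hp)
        · exact rel_zero_of_eq _ _ _ hl (by rw [hS0 g hg, hPg g hg]) (Or.inl (hPg g hg))
      rw [hmin r j hall a]; ring
    · -- `c = h`: a copy of `Q₀`, excluded by `hjQ`
      exfalso
      have hch : (D.P j).charge T.f = (D.N T.i).charge T.f := le_antisymm hle' hge
      refine hjQ ⟨hPg T.σ T.hσf, fun g hg => ?_⟩
      by_cases hgf : g = T.f
      · rw [hgf]
        exact rel_zero_of_eq _ _ _ (hSl.symm.trans hl) hch.symm (Or.inr ((hSph.symm.trans hp).symm ▸ rfl))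
      · exact rel_zero_of_eq _ _ _ (hSl.symm.trans hl) (by rw [T.flag_supp g hg hgf, hPg g hgf]) (Or.inl (hPg g hgf))

/-- **(R1) THE SERVER ROWS READ.** -/
theorem column_reading_R1 (hmin : D.Minimal φ) (η : Fin D.nP → (Fin 4 → ℕ) → (Fin 4 → ℕ × ℕ) → ℂ)
    (hη : ∀ r, ∀ t ∈ idxH2 (D.N r) (D.N T.i), D.lowerLHS φ η T.i r t =
      if r = T.i then ob (D.N T.i) (Matrix.of fun a b => if a = T.f ∧ b = T.σ then (1 : ℂ) else 0) t.1 t.2 else 0)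
    {r : Fin D.nN} (hr : T.IsServer r) {x : ℕ × ℕ} (hx : x ∈ monIdx ((D.N T.i).charge T.σ)) {o : ℕ × ℕ}
    (ho : o ∈ monIdx ((D.N r).charge T.f - (D.N T.i).charge T.f)) :
    ∑ j ∈ T.q0Set,
        (η j (qPair T.σ T.f) (Function.update (Function.update (fun _ => ((0 : ℕ), (0 : ℕ))) T.σ x) T.f (1, 0)) -
            zetaBar ((D.N T.i).phase T.f) *
              η j (qPair T.σ T.f) (Function.update (Function.update (fun _ => ((0 : ℕ), (0 : ℕ))) T.σ x) T.f (0, 0))) *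
          φ r j (Function.update (fun _ => ((0 : ℕ), (0 : ℕ))) T.f o) +
      ∑ j ∈ T.compSet ((D.N r).charge T.f), ∑ ι' ∈ monIdx ((D.P j).charge T.f - (D.N T.i).charge T.f),
        ∑ a' ∈ monIdx ((D.N r).charge T.f - (D.P j).charge T.f),
          (mulCoef ι' a' o : ℂ) *
            η j (qPair T.σ T.f) (Function.update (Function.update (fun _ => ((0 : ℕ), (0 : ℕ))) T.σ x) T.f ι') *
            φ r j (Function.update (fun _ => ((0 : ℕ), (0 : ℕ))) T.f a') = 0 := by
  classical
  have hri : r ≠ T.i := fun h => by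
    have := hr.2.2.2 T.σ T.hσf; rw [h] at this; exact T.flag_σ this
  -- the coordinate `t = (qPair σ f, [σ ↦ x, f ↦ o])` of `H²(S − X)`
  have hσR : rel (D.N r) (D.N T.i) T.σ = Rel.neg ((D.N T.i).charge T.σ) ((D.N T.i).phase T.σ) :=
    rel_uncharged_charged _ _ T.σ hr.1 (hr.2.2.2 T.σ T.hσf) T.flag_σ
  have hfR : rel (D.N r) (D.N T.i) T.f = Rel.pos ((D.N r).charge T.f - (D.N T.i).charge T.f) ((D.N r).phase T.f) :=
    rel_pos_of_lt _ _ T.f hr.1 hr.2.2.1 (Or.inr hr.2.1)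
  have hR0 : ∀ g, g ≠ T.σ → g ≠ T.f → rel (D.N r) (D.N T.i) g = Rel.zero := fun g hgσ hgf =>
    rel_zero_of_eq _ _ g hr.1 (by rw [hr.2.2.2 g hgf, T.flag_supp g hgσ hgf]) (Or.inl (T.flag_supp g hgσ hgf))
  have ht : (qPair T.σ T.f, Function.update (Function.update (fun _ => ((0 : ℕ), (0 : ℕ))) T.σ x) T.f o) ∈
      idxH2 (D.N r) (D.N T.i) := by
    refine (mem_idxH2_iff _ _ _).2 ⟨qPair_mem_qDist2 _ _ T.hσf, fun g => ?_⟩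
    dsimp only
    by_cases hgf : g = T.f
    · subst hgf; rw [Function.update_self, hfR, qPair_right, idx_pos_one]; exact ho
    by_cases hgσ : g = T.σ
    · subst hgσ; rw [Function.update_of_ne T.hσf, Function.update_self, hσR, qPair_left, idx_neg_one]; exact hx
    rw [update_update_apply_of_ne hgσ hgf, hR0 g hgσ hgf, qPair_of_ne hgσ hgf, idx_zero_zero]
    exact mem_singleton_self _
  have row := hη r _ ht
  rw [if_neg hri] at row
  simp only [Design.lowerLHS] at row
  -- split the `j`-sum: copies of `Q₀`, companions below `S`, and the rest (zero)
  have hsplit : ∀ j, (∑ u ∈ idxH2 (D.P j) (D.N T.i), ∑ a ∈ idxH0 (D.N r) (D.P j),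
      (if u.1 = qPair T.σ T.f then coefProd (rel (D.P j) (D.N T.i)) (rel (D.N r) (D.P j)) (qPair T.σ T.f) u.2 a
        (Function.update (Function.update (fun _ => ((0 : ℕ), (0 : ℕ))) T.σ x) T.f o) else 0) * φ r j a * η j u.1 u.2) =
      (if T.IsQ0 j then
        (η j (qPair T.σ T.f) (Function.update (Function.update (fun _ => ((0 : ℕ), (0 : ℕ))) T.σ x) T.f (1, 0)) -
            zetaBar ((D.N T.i).phase T.f) *
              η j (qPair T.σ T.f) (Function.update (Function.update (fun _ => ((0 : ℕ), (0 : ℕ))) T.σ x) T.f (0, 0))) *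
          φ r j (Function.update (fun _ => ((0 : ℕ), (0 : ℕ))) T.f o) else 0) +
      (if T.IsComp j ∧ (D.P j).charge T.f < (D.N r).charge T.f then
        ∑ ι' ∈ monIdx ((D.P j).charge T.f - (D.N T.i).charge T.f),
          ∑ a' ∈ monIdx ((D.N r).charge T.f - (D.P j).charge T.f),
            (mulCoef ι' a' o : ℂ) *
              η j (qPair T.σ T.f) (Function.update (Function.update (fun _ => ((0 : ℕ), (0 : ℕ))) T.σ x) T.f ι') *
              φ r j (Function.update (fun _ => ((0 : ℕ), (0 : ℕ))) T.f a') else 0) := by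
    intro j
    by_cases hQ : T.IsQ0 j
    · have hnc : ¬ (T.IsComp j ∧ (D.P j).charge T.f < (D.N r).charge T.f) := fun hc => by
        have := (topFlag_Q0 D φ T j hQ).2.1; have := hc.1.2.2.1; omega
      rw [if_pos hQ, if_neg hnc, add_zero, server_term_isQ0 T η hr hQ hx ho]
    by_cases hC : T.IsComp j ∧ (D.P j).charge T.f < (D.N r).charge T.f
    · rw [if_neg hQ, if_pos hC, zero_add, server_term_isComp T η hr hC.1 hC.2 hx o]
    · rw [if_neg hQ, if_neg hC, add_zero, server_term_zero T hmin η hr hQ hC x o]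
  simp_rw [hsplit, Finset.sum_add_distrib, ← Finset.sum_filter] at row
  unfold TopFlag.q0Set TopFlag.compSet
  exact row

end Rows

end Summit.Ventures.HSemireg.Pad4FirstOrder
end
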